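import Mathlib
import Literature.Computability.AlgebraicComplexity.StandardFamilies
import Summits.ValiantsHypothesis.ValiantsHypothesis.Theorems.RefutationDegreeDefs
import Summits.ValiantsHypothesis.ValiantsHypothesis.Theorems.RefutationDegreeBeyondHessianNsStubOddInfeasible
import Summits.ValiantsHypothesis.ValiantsHypothesis.Theorems.RefutationDegreeRefutationBarrierStubBorderGapDichotomy
import Summits.ValiantsHypothesis.ValiantsHypothesis.Theorems.RefutationDegreeRefutationBarrierStubNcFullRankOfBalanced

/-!
# Crux `RefutationBarrier` (stmt-ValiantsHypothesis-5642), line `Sketch_ideator5` (lead c2):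
# confinement of a border gap at the critical odd size (cards `kernel-pair-rays-plus-one` +
# `balanced-singular-limits` composed)

Modulo Skoda–Brownawell the crux forces `per_n` into the affine border at size `m₁ = ⌊n²/2⌋ + 1`
for all large `n` (`inBorder_of_refutationBarrier`, landed), and at ODD `n ≥ 3` the size-`m₁` system is
INFEASIBLE (Mignon–Ressayre + 1, `…BeyondHessianNs.not_hasDetRepr_of_odd`, p111216).  The card's
Kempf–Ness lever says what such a genuine border/exact gap must look like: by the dichotomy
(`stub_border_gap_dichotomy`, p135012) and Gurvits–King (`stub_ncFullRank_of_balanced`, p134360),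
there is a sup-norm-one BALANCED tuple `(W₀, (W_e))` of `m₁ × m₁` matrices (`Σ W_t W_tᴴ = α·1 = Σ W_tᴴ W_t`)
spanning a SINGULAR matrix space (`det(W₀ + Σ x_e W_e) ≡ 0`) of full NON-COMMUTATIVE rank (no shrunk
subspace) — an Edmonds-gap space (`balancedSingular_of_inBorder_odd`).  Also recorded: the card's
first lemma `mr_plus_one` under its card name (a one-line alias of the landed theorem).
-/

set_option linter.dupNamespace false

noncomputable section

namespace Summit.ValiantsHypothesis.ValiantsHypothesis.Theorems.RefutationDegree

open scoped BigOperators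
open MvPolynomial Matrix
open Literature.Computability.AlgebraicComplexity (perPoly HasDetRepr)
open Summit.ValiantsHypothesis.ValiantsHypothesis.Theorems.RefutationDegreeBeyondHessianNs
  (sq_add_two_le_two_mul_of_hasDetRepr_perPoly not_hasDetRepr_of_odd)

/-- **Mignon–Ressayre + 1** (card `kernel-pair-rays-plus-one`, first lemma; LANDED as
`…RefutationDegreeBeyondHessianNs.sq_add_two_le_two_mul_of_hasDetRepr_perPoly`, p111216): for
`n ≥ 3` every affine determinantal expression of `per_n` of size `m` has `n² + 2 ≤ 2m`. -/
theorem mr_plus_one {n m : ℕ} (hn : 3 ≤ n) (h : HasDetRepr (perPoly (Fin n) ℂ) m) :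
    n ^ 2 + 2 ≤ 2 * m :=
  sq_add_two_le_two_mul_of_hasDetRepr_perPoly hn h

/-- **Confinement of the border gap at the critical odd size.**  At odd `n ≥ 3`, affine border
membership of `per_n` at size `⌊n²/2⌋+1` can only come from a sup-norm-one BALANCED tuple spanning a
SINGULAR matrix space of full non-commutative rank (an Edmonds-gap space): the exact alternative of
the Kempf–Ness dichotomy is excluded by MR + 1, and a non-zero balanced tuple has no shrunk subspace. -/
theorem balancedSingular_of_inBorder_odd {n : ℕ} (hn : 3 ≤ n) (ho : Odd n)
    (hb : InBorder n (n ^ 2 / 2 + 1)) :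
    ∃ W : Unk n (n ^ 2 / 2 + 1) → ℂ, ‖W‖ = 1 ∧
      (∃ α : ℝ,
        (∑ t : Option (Fin n × Fin n),
            (Matrix.of fun i j : Fin (n ^ 2 / 2 + 1) => W (t, (i, j))) *
              (Matrix.of fun i j : Fin (n ^ 2 / 2 + 1) => W (t, (i, j)))ᴴ) =
          (α : ℂ) • (1 : Matrix (Fin (n ^ 2 / 2 + 1)) (Fin (n ^ 2 / 2 + 1)) ℂ) ∧
        (∑ t : Option (Fin n × Fin n),
            (Matrix.of fun i j : Fin (n ^ 2 / 2 + 1) => W (t, (i, j)))ᴴ *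
              (Matrix.of fun i j : Fin (n ^ 2 / 2 + 1) => W (t, (i, j)))) =
          (α : ℂ) • (1 : Matrix (Fin (n ^ 2 / 2 + 1)) (Fin (n ^ 2 / 2 + 1)) ℂ)) ∧
      (∀ μ : (Fin n × Fin n) →₀ ℕ, eval W (((pencil n (n ^ 2 / 2 + 1)).det).coeff μ) = 0) ∧
      ∀ U : Submodule ℂ (Fin (n ^ 2 / 2 + 1) → ℂ),
        Module.finrank ℂ U ≤
          Module.finrank ℂ
            ↥(⨆ t : Option (Fin n × Fin n),
                U.map (Matrix.toLin'
                  (Matrix.of fun i j : Fin (n ^ 2 / 2 + 1) => W (t, (i, j))))) := by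
  rcases stub_border_gap_dichotomy n (n ^ 2 / 2 + 1) hb with h | ⟨W, hW1, hbal, hsing⟩
  · exact absurd h (not_hasDetRepr_of_odd hn ho)
  · have hW0 : W ≠ 0 := by
      rintro rfl
      simp at hW1
    exact ⟨W, hW1, hbal, hsing, stub_ncFullRank_of_balanced n _ W hW0 hbal⟩

end Summit.ValiantsHypothesis.ValiantsHypothesis.Theorems.RefutationDegree

end
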